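import Summits.AtomisticToContinuum.Crystallization.Theses.ChessboardParticlePlanes
import Summits.AtomisticToContinuum.Crystallization.Theorems.ChessboardParticlePlanesLjPlaneChessboardDeficitSite
import Summits.AtomisticToContinuum.Crystallization.Theorems.ChessboardParticlePlanesLjPlaneChessboardLayerPlanar
import Summits.AtomisticToContinuum.Crystallization.Theorems.ChessboardParticlePlanesLjPlaneChessboardSiteSumQ
import Summits.AtomisticToContinuum.Crystallization.Theorems.ChessboardParticlePlanesLjPlaneChessboardSiteSumUp
import Summits.AtomisticToContinuum.Crystallization.Theorems.ChessboardParticlePlanesLjPlaneChessboardSiteSumDn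
import Summits.AtomisticToContinuum.Crystallization.Theorems.ChessboardParticlePlanesLjPlaneChessboardHeightSplit
import Summits.AtomisticToContinuum.Crystallization.Theorems.ChessboardParticlePlanesLjPlaneChessboardDeficitKernelAux

/-!
# Crux `ChessboardParticlePlanes.LjPlaneChessboard` (stmt-AtomisticToContinuum-6709), line `Sketch`,
# stub `deficitSite_kernelForm` — the per-site deficit as a planar matrix-kernel lattice form

Let `Q` be a periodic configuration of `ℝ³` with horizontal `ℝ`-independent periods `a, b`
generating all horizontal periods, `L = ℤ πa + ℤ πb ⊆ ℝ²` the planar lattice (`π y = !₂[y 0, y 1]`),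
`g₀ ∈ Q.lattice` the vertical period, `z : ℤ → ℝ` the strictly increasing enumeration of the
occupied heights (`z (i + n) = z i + g₀ 2`, heights pairwise `≥ 3/4` apart), and `F : ℤ → Finset`
a vertically periodic presentation of the layers (layer `m` is `F m + ℤa + ℤb`,
`F (m + n) = F m + g₀`).  For `x ∈ F i₀`, `i₀ < n`, write `K(ζ, ρ) = V_LJ(√(‖ρ‖² + ζ²))`,
`c = z (i₀+1) - z i₀`, `c' = z i₀ - z (i₀-1)`.

CLAIM (registered sub-goal).  The per-site chessboard deficit `2 S_Q(x) - S_up(x) - S_dn(x)` equals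
`Σ_{m<n} Σ_{f' ∈ F m} Σ'_{v ∈ L} Σ'_{j ∈ ℤ} [A - B - C - D](m, f', v, j)`, where with
`ρ = πx - πf' - v`: `A = 2 K(z i₀ - z (m + jn), ρ - j πg₀)` off `m + jn = i₀` (else `0`),
`B = Σ'_{k ≠ 0} (K(2|k|c, ρ) + K(2|k|c', ρ))` on `m + jn = i₀`, `C = Σ'_k K(|2k+1|c, ρ - j πg₀)` on
`m + jn = i₀ + 1`, `D = Σ'_k K(|2k+1|c', ρ - j πg₀)` on `m + jn = i₀ - 1` (else `0`).

PROOF (bookkeeping, [folklore]; the general lemmas are in `…DeficitKernelAux.lean`).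
`deficitSite_layerForm` writes the deficit as `2 Σ'_{m' ≠ i₀} T(m') - (B₁ + C₁) - (B₂ + D₁)` with
layer sums over the planes of `Q`, and `layerSum_planar` turns every layer sum into
`Σ_{f ∈ F m'} Σ'_{v ∈ L} K(ζ, πx - πf - v)`.  The cross-plane part is re-indexed by `m' = m + jn`,
`0 ≤ m < n` (`deficitKernel_tsum_ne_int`), `F (m + jn)` is `F m` shifted by `j g₀`
(`deficitKernel_presentation_shift`), and `Σ'_j` is moved inside `Σ_{f'} Σ'_v`
(`deficitKernel_exch`), the summability on `L × ℤ` being `deficitKernel_cross_summable` (injection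
into the absolutely summable site sum of `Q`) resp. planar decay for the restack parts
(`deficitKernel_prod_summable_even/odd`).  Finally the conditions `m + jn = i₀`, `i₀ ± 1` have
unique solutions `(m, j)` with `0 ≤ m < n` (`deficitKernel_index_iff`), so the `j`-sums of
`B, C, D` collapse (`tsum_ite_eq`) and the `m`-sums pick one residue (`Finset.sum_eq_single`).
No definition and no notation is introduced.
-/

noncomputable section

namespace Summit.AtomisticToContinuum.Crystallization.Theorems.ChessboardParticlePlanesLjPlaneChessboard

open Literature.MathematicalPhysics.StatisticalMechanics

/-- **Registered sub-goal `deficitSite_kernelForm`: the per-site chessboard deficit as a finite sum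
of planar lattice sums of a matrix kernel.**  For `x ∈ F i₀` (`i₀ < n`) the deficit
`2 S_Q(x) - S_up(x) - S_dn(x)` equals `Σ_{m<n} Σ_{f' ∈ F m} Σ'_{v ∈ L} Σ'_j [A - B - C - D]` with
the cross terms `A` of all other layers `m + jn ≠ i₀` (layer `F m` shifted by `j g₀`), the
self-copy sums `B` at `m + jn = i₀`, and the partner sums `C`, `D` at `m + jn = i₀ ± 1`
(`deficitSite_layerForm`, `layerSum_planar`, re-indexing `m' = m + jn` and exchange of the sums by
absolute summability). [folklore] -/
theorem deficitSite_kernelForm :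
    ∀ (Q : PeriodicConfiguration 3) (τu τd : ℝ → ℝ) (a b g₀ : EuclideanSpace ℝ (Fin 3))
      (z : ℤ → ℝ) (n : ℕ) (F : ℤ → Finset (EuclideanSpace ℝ (Fin 3)))
      (L : Submodule ℤ (EuclideanSpace ℝ (Fin 2))) [DiscreteTopology L] [IsZLattice ℝ L]
      (i₀ : ℕ) (x : EuclideanSpace ℝ (Fin 3)),
      (∀ x' ∈ Q.points, ∀ y ∈ Q.points, x' 2 ≠ y 2 → (3 : ℝ) / 4 ≤ |x' 2 - y 2|) →
      a ∈ Q.lattice → b ∈ Q.lattice → a 2 = 0 → b 2 = 0 → LinearIndependent ℝ ![a, b] →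
      (∀ v : EuclideanSpace ℝ (Fin 2),
        v ∈ L ↔ ∃ k l : ℤ, v = (k : ℝ) • !₂[a 0, a 1] + (l : ℝ) • !₂[b 0, b 1]) →
      g₀ ∈ Q.lattice → 0 < n → StrictMono z → (∀ i : ℤ, z (i + n) = z i + g₀ 2) →
      (∀ y ∈ Q.points, ∃ i : ℤ, y 2 = z i) → (∀ i : ℤ, ∃ y ∈ Q.points, y 2 = z i) →
      (∀ i : ℤ, z (i + 1) = τu (z i)) → (∀ i : ℤ, τd (z (i + 1)) = z i) →
      (∀ m : ℤ, ∀ f ∈ F m, f 2 = z m ∧ f ∈ Q.points) →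
      (∀ m : ℤ, ∀ f ∈ F m, ∀ f' ∈ F m, f ≠ f' → ∀ k l : ℤ, f' ≠ f + (k : ℝ) • a + (l : ℝ) • b) →
      (∀ (m : ℤ) (y : EuclideanSpace ℝ (Fin 3)),
        (y ∈ Q.points ∧ y 2 = z m) ↔ ∃ f ∈ F m, ∃ k l : ℤ, y = f + (k : ℝ) • a + (l : ℝ) • b) →
      (∀ m : ℤ, F (m + n) = (F m).image (fun f => f + g₀)) →
      i₀ < n → x ∈ F i₀ →
      2 * (∑' y : {y : EuclideanSpace ℝ (Fin 3) // y ∈ Q.points ∧ y ≠ x}, lennardJones (dist x y.1))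
        - (∑' y : {y : EuclideanSpace ℝ (Fin 3) //
              y ∈ {p : EuclideanSpace ℝ (Fin 3) | ∃ k : ℤ, ∃ x' ∈ Q.points,
                (x' 2 = x 2 ∨ x' 2 = τu (x 2)) ∧
                p = x' + ((2 * (τu (x 2) - x 2)) * (k : ℝ)) •
                  EuclideanSpace.single (2 : Fin 3) (1 : ℝ)} ∧ y ≠ x},
              lennardJones (dist x y.1))
        - (∑' y : {y : EuclideanSpace ℝ (Fin 3) //
              y ∈ {p : EuclideanSpace ℝ (Fin 3) | ∃ k : ℤ, ∃ x' ∈ Q.points,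
                (x' 2 = τd (x 2) ∨ x' 2 = x 2) ∧
                p = x' + ((2 * (x 2 - τd (x 2))) * (k : ℝ)) •
                  EuclideanSpace.single (2 : Fin 3) (1 : ℝ)} ∧ y ≠ x},
              lennardJones (dist x y.1)) =
      ∑ m ∈ Finset.range n, ∑ f' ∈ F m, ∑' v : L,
        ∑' j : ℤ,
          ((if (m : ℤ) + j * n = (i₀ : ℤ) then 0 else
              2 * lennardJones (Real.sqrt
                (‖!₂[x 0, x 1] - !₂[f' 0, f' 1] - (j : ℝ) • !₂[g₀ 0, g₀ 1]
                    - (v : EuclideanSpace ℝ (Fin 2))‖ ^ 2 + (z (i₀ : ℤ) - z ((m : ℤ) + j * n)) ^ 2)))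
            - (if (m : ℤ) + j * n = (i₀ : ℤ) then
                ∑' k : {k : ℤ // k ≠ 0},
                  (lennardJones (Real.sqrt
                      (‖!₂[x 0, x 1] - !₂[f' 0, f' 1] - (v : EuclideanSpace ℝ (Fin 2))‖ ^ 2
                        + (2 * |(k : ℝ)| * (z ((i₀ : ℤ) + 1) - z (i₀ : ℤ))) ^ 2)) +
                   lennardJones (Real.sqrt
                      (‖!₂[x 0, x 1] - !₂[f' 0, f' 1] - (v : EuclideanSpace ℝ (Fin 2))‖ ^ 2
                        + (2 * |(k : ℝ)| * (z (i₀ : ℤ) - z ((i₀ : ℤ) - 1))) ^ 2)))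
               else 0)
            - (if (m : ℤ) + j * n = (i₀ : ℤ) + 1 then
                ∑' k : ℤ, lennardJones (Real.sqrt
                  (‖!₂[x 0, x 1] - !₂[f' 0, f' 1] - (j : ℝ) • !₂[g₀ 0, g₀ 1]
                      - (v : EuclideanSpace ℝ (Fin 2))‖ ^ 2
                    + (|2 * (k : ℝ) + 1| * (z ((i₀ : ℤ) + 1) - z (i₀ : ℤ))) ^ 2))
               else 0)
            - (if (m : ℤ) + j * n = (i₀ : ℤ) - 1 then
                ∑' k : ℤ, lennardJones (Real.sqrt
                  (‖!₂[x 0, x 1] - !₂[f' 0, f' 1] - (j : ℝ) • !₂[g₀ 0, g₀ 1]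
                      - (v : EuclideanSpace ℝ (Fin 2))‖ ^ 2
                    + (|2 * (k : ℝ) + 1| * (z (i₀ : ℤ) - z ((i₀ : ℤ) - 1))) ^ 2))
               else 0)) := by
  intro Q τu τd a b g₀ z n F L _ _ i₀ x hsep ha hb ha2 hb2 hab hL hg₀ hn hz hzn hcov hocc hτu hτd
    hFmem hFne hFlayer hFper hi₀ hxF
  -- (0) basic facts: `x` is a point on the plane `i₀`; gaps between occupied heights are `≥ 3/4`
  have hx : x ∈ Q.points := (hFmem _ x hxF).2
  have hxz : x 2 = z i₀ := (hFmem _ x hxF).1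
  have hn' : (n : ℤ) ≠ 0 := by exact_mod_cast hn.ne'
  have hgap : ∀ i i' : ℤ, i ≠ i' → (3 : ℝ) / 4 ≤ |z i - z i'| := by
    intro i i' hii'
    obtain ⟨y, hy, hy2⟩ := hocc i
    obtain ⟨y', hy', hy2'⟩ := hocc i'
    have h := hsep y hy y' hy' (by rw [hy2, hy2']; exact fun h => hii' (hz.injective h))
    rwa [hy2, hy2'] at h
  have hc34 : (3 : ℝ) / 4 ≤ z ((i₀ : ℤ) + 1) - z i₀ := by
    have h := hgap ((i₀ : ℤ) + 1) i₀ (by omega)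
    rwa [abs_of_pos (sub_pos.2 (hz (lt_add_one _)))] at h
  have hc'34 : (3 : ℝ) / 4 ≤ z (i₀ : ℤ) - z ((i₀ : ℤ) - 1) := by
    have h := hgap (i₀ : ℤ) ((i₀ : ℤ) - 1) (by omega)
    rwa [abs_of_pos (sub_pos.2 (hz (sub_one_lt _)))] at h
  have hodd : ∀ k : ℤ, (1 : ℝ) ≤ |2 * (k : ℝ) + 1| := fun k => by
    exact_mod_cast (Int.one_le_abs (by omega) : (1 : ℤ) ≤ |2 * k + 1|)
  -- (1) the layer form of the deficit
  rw [deficitSite_layerForm Q τu τd z i₀ x ⟨a, ha, b, hb, ha2, hb2, hab⟩ hsep hz hcov hocc hτu hτd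
    hx hxz]
  -- (2) every layer sum in planar coordinates
  have hTm : ∀ m' : ℤ, m' ≠ i₀ →
      ∑' y : {y : EuclideanSpace ℝ (Fin 3) // y ∈ Q.points ∧ y 2 = z m'},
          lennardJones (Real.sqrt (‖x - y.1‖ ^ 2 - (x 2 - z m') ^ 2 + (z i₀ - z m') ^ 2)) =
        ∑ f ∈ F m', ∑' v : L, lennardJones (Real.sqrt
          (‖!₂[x 0, x 1] - !₂[f 0, f 1] - (v : EuclideanSpace ℝ (Fin 2))‖ ^ 2
            + (z i₀ - z m') ^ 2)) := by
    intro m' hm'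
    have hζ : 0 < |z i₀ - z m'| := abs_pos.2 (sub_ne_zero.2 fun h => hm' (hz.injective h).symm)
    have h := (layerSum_planar Q a b (F m') (z m') |z i₀ - z m'| x L ha hb ha2 hb2 hab hL
      (hFmem m') (hFne m') (hFlayer m') hζ).2
    simpa only [sq_abs] using h
  have hB : ∀ ζ : ℝ, 0 < ζ →
      ∑' y : {y : EuclideanSpace ℝ (Fin 3) // y ∈ Q.points ∧ y 2 = x 2},
          lennardJones (Real.sqrt (‖x - y.1‖ ^ 2 + ζ ^ 2)) =
        ∑ f ∈ F i₀, ∑' v : L, lennardJones (Real.sqrt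
          (‖!₂[x 0, x 1] - !₂[f 0, f 1] - (v : EuclideanSpace ℝ (Fin 2))‖ ^ 2 + ζ ^ 2)) := by
    intro ζ hζ
    have h := (layerSum_planar Q a b (F i₀) (x 2) ζ x L ha hb ha2 hb2 hab hL
      (fun f hf => ⟨(hFmem _ f hf).1.trans hxz.symm, (hFmem _ f hf).2⟩) (hFne _)
      (fun y => by rw [hxz]; exact hFlayer _ y) hζ).2
    simpa only [sub_self, ne_eq, OfNat.ofNat_ne_zero, not_false_eq_true, zero_pow, sub_zero]
      using h
  have hCD : ∀ (i : ℤ) (ζ : ℝ), 0 < ζ →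
      ∑' y : {y : EuclideanSpace ℝ (Fin 3) // y ∈ Q.points ∧ y 2 = z i},
          lennardJones (Real.sqrt (‖x - y.1‖ ^ 2 - (x 2 - z i) ^ 2 + ζ ^ 2)) =
        ∑ f ∈ F i, ∑' v : L, lennardJones (Real.sqrt
          (‖!₂[x 0, x 1] - !₂[f 0, f 1] - (v : EuclideanSpace ℝ (Fin 2))‖ ^ 2 + ζ ^ 2)) :=
    fun i ζ hζ => (layerSum_planar Q a b (F i) (z i) ζ x L ha hb ha2 hb2 hab hL (hFmem i) (hFne i)
      (hFlayer i) hζ).2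
  rw [tsum_congr fun m' : {m : ℤ // m ≠ (i₀ : ℤ)} => hTm m'.1 m'.2,
    tsum_congr fun k : {k : ℤ // k ≠ 0} => hB (2 * |(k : ℝ)| * (z ((i₀ : ℤ) + 1) - z i₀))
      (by have : (1 : ℝ) ≤ |(k : ℝ)| := by exact_mod_cast Int.one_le_abs k.2
          nlinarith),
    tsum_congr fun k : {k : ℤ // k ≠ 0} => hB (2 * |(k : ℝ)| * (z (i₀ : ℤ) - z ((i₀ : ℤ) - 1)))
      (by have : (1 : ℝ) ≤ |(k : ℝ)| := by exact_mod_cast Int.one_le_abs k.2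
          nlinarith),
    tsum_congr fun k : ℤ => hCD ((i₀ : ℤ) + 1) (|2 * (k : ℝ) + 1| * (z ((i₀ : ℤ) + 1) - z i₀))
      (by nlinarith [hodd k]),
    tsum_congr fun k : ℤ => hCD ((i₀ : ℤ) - 1) (|2 * (k : ℝ) + 1| * (z (i₀ : ℤ) - z ((i₀ : ℤ) - 1)))
      (by nlinarith [hodd k])]
  -- (3) notation: the planar kernel `K`, the projection `π`, the gaps `c`, `c'`
  obtain ⟨K, hK⟩ : ∃ K : ℝ → EuclideanSpace ℝ (Fin 2) → ℝ,
      ∀ ζ ρ, K ζ ρ = lennardJones (Real.sqrt (‖ρ‖ ^ 2 + ζ ^ 2)) := ⟨_, fun _ _ => rfl⟩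
  obtain ⟨π, hπ⟩ : ∃ π : EuclideanSpace ℝ (Fin 3) → EuclideanSpace ℝ (Fin 2),
      ∀ y, π y = !₂[y 0, y 1] := ⟨_, fun _ => rfl⟩
  simp only [← hK, ← hπ]
  set c : ℝ := z ((i₀ : ℤ) + 1) - z i₀ with hc
  set c' : ℝ := z (i₀ : ℤ) - z ((i₀ : ℤ) - 1) with hc'
  -- (4) planar bookkeeping: `π` is additive; periodicity of the presentation `F` along `g₀`
  have hπadd : ∀ (f : EuclideanSpace ℝ (Fin 3)) (t : ℝ), π (f + t • g₀) = π f + t • π g₀ :=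
    fun f t => by ext i; fin_cases i <;> simp [hπ]
  have hFimg := deficitKernel_presentation_shift F g₀ n hFper
  have hFsh : ∀ (j m : ℤ) (f : EuclideanSpace ℝ (Fin 3)), f ∈ F m →
      f + (j : ℝ) • g₀ ∈ F (m + j * n) :=
    fun j m f hf => by rw [hFimg]; exact Finset.mem_image_of_mem _ hf
  have hFsum : ∀ (j m : ℤ) (g : EuclideanSpace ℝ (Fin 3) → ℝ),
      ∑ f ∈ F (m + j * n), g f = ∑ f ∈ F m, g (f + (j : ℝ) • g₀) := fun j m g => by
    rw [hFimg, Finset.sum_image fun f _ f' _ h => add_right_cancel h]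
  -- (5) summability on `L × ℤ`: cross-plane families (injection into the site sum of `Q`) and
  -- restack families (planar decay)
  have hAprod : ∀ (m : ℤ), ∀ f' ∈ F m, Summable fun p : L × ℤ =>
      K (z i₀ - z (m + p.2 * n)) (π x - π f' - (p.2 : ℝ) • π g₀ - p.1) := fun m f' hf' => by
    simp only [hK, hπ]
    exact deficitKernel_cross_summable Q a b g₀ x z n F L i₀ ha2 hb2 hab hL hn hz hxz hFmem hFlayer
      hFsh hf'
  have prodB : ∀ (X : EuclideanSpace ℝ (Fin 2)) {d : ℝ}, 3 / 4 ≤ d →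
      Summable fun p : L × {k : ℤ // k ≠ 0} =>
        K (2 * |(p.2 : ℝ)| * d) (X - (p.1 : EuclideanSpace ℝ (Fin 2))) := fun X d hd => by
    simp only [hK]
    exact deficitKernel_prod_summable_even L X hd
  have prodC : ∀ (X : EuclideanSpace ℝ (Fin 2)) {d : ℝ}, 3 / 4 ≤ d →
      Summable fun p : L × ℤ =>
        K (|2 * (p.2 : ℝ) + 1| * d) (X - (p.1 : EuclideanSpace ℝ (Fin 2))) := fun X d hd => by
    simp only [hK]
    exact deficitKernel_prod_summable_odd L X d hd
  -- (6) summability of the cross-plane family over the planes (`siteSum_layers_Q`)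
  have hS1 : Summable fun m' : {m : ℤ // m ≠ (i₀ : ℤ)} =>
      ∑ f ∈ F m', ∑' v : L, K (z i₀ - z m') (π x - π f - v) := by
    refine (siteSum_layers_Q siteSum_heightSplit Q z i₀ x hz hcov hx hxz).1.congr fun m' => ?_
    rw [hTm m'.1 m'.2]
    simp only [hK, hπ]
  -- (7) the residues of `i₀ + 1`, `i₀ - 1` modulo `n`; the conditions have unique solutions
  obtain ⟨Mu, Ju, hMJu, hMu0, hMun⟩ : ∃ M J : ℤ, (i₀ : ℤ) + 1 = M + J * n ∧ 0 ≤ M ∧ M < n :=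
    ⟨_, _, (Int.emod_add_ediv_mul _ _).symm, Int.emod_nonneg _ hn',
      Int.emod_lt_of_pos _ (by exact_mod_cast hn)⟩
  obtain ⟨Md, Jd, hMJd, hMd0, hMdn⟩ : ∃ M J : ℤ, (i₀ : ℤ) - 1 = M + J * n ∧ 0 ≤ M ∧ M < n :=
    ⟨_, _, (Int.emod_add_ediv_mul _ _).symm, Int.emod_nonneg _ hn',
      Int.emod_lt_of_pos _ (by exact_mod_cast hn)⟩
  have idxB : ∀ {m : ℕ}, m < n → ∀ j : ℤ, ((m : ℤ) + j * n = i₀ ↔ (m : ℤ) = i₀ ∧ j = 0) :=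
    fun hm j => by
      simpa using deficitKernel_index_iff hm (M := i₀) (by positivity) (by exact_mod_cast hi₀) j 0
  have idxC : ∀ {m : ℕ}, m < n → ∀ j : ℤ, ((m : ℤ) + j * n = i₀ + 1 ↔ (m : ℤ) = Mu ∧ j = Ju) :=
    fun hm j => by rw [hMJu]; exact deficitKernel_index_iff hm hMu0 hMun j Ju
  have idxD : ∀ {m : ℕ}, m < n → ∀ j : ℤ, ((m : ℤ) + j * n = i₀ - 1 ↔ (m : ℤ) = Md ∧ j = Jd) :=
    fun hm j => by rw [hMJd]; exact deficitKernel_index_iff hm hMd0 hMdn j Jd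
  -- (8) names for the four families of the kernel form
  obtain ⟨KA, hKA⟩ : ∃ KA : ℕ → EuclideanSpace ℝ (Fin 3) → ℤ → L → ℝ, ∀ m f' j v,
      KA m f' j v = K (z i₀ - z ((m : ℤ) + j * n)) (π x - π f' - (j : ℝ) • π g₀ - v) :=
    ⟨_, fun _ _ _ _ => rfl⟩
  obtain ⟨SB, hSB⟩ : ∃ SB : EuclideanSpace ℝ (Fin 3) → L → ℝ, ∀ f' v,
      SB f' v = ∑' k : {k : ℤ // k ≠ 0},
        (K (2 * |(k : ℝ)| * c) (π x - π f' - v) + K (2 * |(k : ℝ)| * c') (π x - π f' - v)) :=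
    ⟨_, fun _ _ => rfl⟩
  obtain ⟨SC, hSC⟩ : ∃ SC : EuclideanSpace ℝ (Fin 3) → ℤ → L → ℝ, ∀ f' j v,
      SC f' j v = ∑' k : ℤ, K (|2 * (k : ℝ) + 1| * c) (π x - π f' - (j : ℝ) • π g₀ - v) :=
    ⟨_, fun _ _ _ => rfl⟩
  obtain ⟨SD, hSD⟩ : ∃ SD : EuclideanSpace ℝ (Fin 3) → ℤ → L → ℝ, ∀ f' j v,
      SD f' j v = ∑' k : ℤ, K (|2 * (k : ℝ) + 1| * c') (π x - π f' - (j : ℝ) • π g₀ - v) :=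
    ⟨_, fun _ _ _ => rfl⟩
  simp only [← hKA, ← hSB, ← hSC, ← hSD]
  -- (9) the left-hand side in kernel form: the cross-plane part ...
  have hAprod₁ : ∀ (m : ℕ), ∀ f' ∈ F m, Summable fun p : L × ℤ =>
      if (m : ℤ) + p.2 * n = i₀ then (0 : ℝ) else KA m f' p.2 p.1 := fun m f' hf' =>
    Summable.of_norm_bounded (hAprod m f' hf').abs fun p => by rw [hKA]; split_ifs <;> simp
  have hA_eq :
      ∑' m' : {m : ℤ // m ≠ (i₀ : ℤ)}, ∑ f ∈ F m', ∑' v : L, K (z i₀ - z m') (π x - π f - v) =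
        ∑ m ∈ Finset.range n, ∑ f' ∈ F m, ∑' v : L, ∑' j : ℤ,
          (if (m : ℤ) + j * n = i₀ then (0 : ℝ) else KA m f' j v) := by
    rw [deficitKernel_tsum_ne_int hn (i₀ : ℤ)
      (g := fun m' => ∑ f ∈ F m', ∑' v : L, K (z i₀ - z m') (π x - π f - v)) hS1]
    refine Finset.sum_congr rfl fun m hm => ?_
    rw [← deficitKernel_exch (F m)
      (fun f' v j => if (m : ℤ) + j * n = i₀ then (0 : ℝ) else KA m f' j v) (hAprod₁ m)]
    refine tsum_congr fun j => ?_
    simp only [hFsum, hπadd, sub_add_eq_sub_sub, hKA]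
    split_ifs
    · simp
    · rfl
  -- ... the self-copy parts ...
  have hB_eq : ∀ {d : ℝ}, 3 / 4 ≤ d →
      ∑' k : {k : ℤ // k ≠ 0}, ∑ f ∈ F i₀, ∑' v : L, K (2 * |(k : ℝ)| * d) (π x - π f - v) =
        ∑ f ∈ F i₀, ∑' v : L, ∑' k : {k : ℤ // k ≠ 0}, K (2 * |(k : ℝ)| * d) (π x - π f - v) :=
    fun hd => deficitKernel_exch (F i₀)
      (fun f v (k : {k : ℤ // k ≠ 0}) => K (2 * |(k : ℝ)| * _) (π x - π f - v))
      fun f _ => prodB _ hd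
  -- ... and the two partner parts, shifted back into the window `0 ≤ m < n`
  have hC_eq :
      ∑' k : ℤ, ∑ f ∈ F ((i₀ : ℤ) + 1), ∑' v : L, K (|2 * (k : ℝ) + 1| * c) (π x - π f - v) =
        ∑ f' ∈ F Mu, ∑' v : L, SC f' Ju v := by
    rw [deficitKernel_exch (F ((i₀ : ℤ) + 1))
      (fun f v (k : ℤ) => K (|2 * (k : ℝ) + 1| * c) (π x - π f - v)) fun f _ => prodC _ hc34,
      hMJu, hFsum]
    simp only [hπadd, sub_add_eq_sub_sub, hSC]
  have hD_eq :
      ∑' k : ℤ, ∑ f ∈ F ((i₀ : ℤ) - 1), ∑' v : L, K (|2 * (k : ℝ) + 1| * c') (π x - π f - v) =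
        ∑ f' ∈ F Md, ∑' v : L, SD f' Jd v := by
    rw [deficitKernel_exch (F ((i₀ : ℤ) - 1))
      (fun f v (k : ℤ) => K (|2 * (k : ℝ) + 1| * c') (π x - π f - v)) fun f _ => prodC _ hc'34,
      hMJd, hFsum]
    simp only [hπadd, sub_add_eq_sub_sub, hSD]
  rw [hA_eq, hB_eq hc34, hB_eq hc'34, hC_eq, hD_eq]
  -- (10) collapsing a sum over `m < n` with a residue condition; splitting the self-copy sums
  have collapse : ∀ (M : ℤ), 0 ≤ M → M < n → ∀ Y : EuclideanSpace ℝ (Fin 3) → L → ℝ,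
      ∑ m ∈ Finset.range n, ∑ f' ∈ F m, ∑' v : L, (if (m : ℤ) = M then Y f' v else 0) =
        ∑ f' ∈ F M, ∑' v : L, Y f' v := by
    intro M hM0 hMn Y
    rw [Finset.sum_eq_single M.toNat]
    · simp [Int.toNat_of_nonneg hM0]
    · intro m _ hm
      have hmM : (m : ℤ) ≠ M := fun h => hm (by rw [← h, Int.toNat_natCast])
      simp [hmM]
    · intro h
      exact absurd (Finset.mem_range.2 (by omega)) h
  have hBsplit : ∑ f' ∈ F (i₀ : ℤ), ∑' v : L, SB f' v =
      (∑ f ∈ F i₀, ∑' v : L, ∑' k : {k : ℤ // k ≠ 0}, K (2 * |(k : ℝ)| * c) (π x - π f - v)) +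
        ∑ f ∈ F i₀, ∑' v : L, ∑' k : {k : ℤ // k ≠ 0}, K (2 * |(k : ℝ)| * c') (π x - π f - v) := by
    rw [← Finset.sum_add_distrib]
    refine Finset.sum_congr rfl fun f' hf' => ?_
    rw [← Summable.tsum_add (prodB _ hc34).prod (prodB _ hc'34).prod]
    refine tsum_congr fun v => ?_
    rw [hSB]
    exact Summable.tsum_add ((prodB _ hc34).prod_factor v) ((prodB _ hc'34).prod_factor v)
  -- (11) the target: split the `j`-sum into the four families and collapse the conditions
  symm
  calc ∑ m ∈ Finset.range n, ∑ f' ∈ F m, ∑' (v : L) (j : ℤ),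
        ((if (m : ℤ) + j * n = i₀ then 0 else 2 * KA m f' j v)
          - (if (m : ℤ) + j * n = i₀ then SB f' v else 0)
          - (if (m : ℤ) + j * n = i₀ + 1 then SC f' j v else 0)
          - (if (m : ℤ) + j * n = i₀ - 1 then SD f' j v else 0))
      = ∑ m ∈ Finset.range n, ∑ f' ∈ F m,
          (2 * (∑' (v : L) (j : ℤ), if (m : ℤ) + j * n = i₀ then (0 : ℝ) else KA m f' j v)
            - (∑' v : L, if (m : ℤ) = i₀ then SB f' v else 0)
            - (∑' v : L, if (m : ℤ) = Mu then SC f' Ju v else 0)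
            - (∑' v : L, if (m : ℤ) = Md then SD f' Jd v else 0)) := by
        refine Finset.sum_congr rfl fun m hm => Finset.sum_congr rfl fun f' hf' => ?_
        have hm' := Finset.mem_range.1 hm
        have h2 := hAprod₁ m f' hf'
        have sβ : Summable fun v : L => if (m : ℤ) = i₀ then SB f' v else 0 := by
          by_cases hmi : (m : ℤ) = i₀ <;> simp only [hmi, if_true, if_false, hSB]
          exacts [((prodB _ hc34).add (prodB _ hc'34)).prod, summable_zero]
        have sγ : Summable fun v : L => if (m : ℤ) = Mu then SC f' Ju v else 0 := by
          by_cases hmC : (m : ℤ) = Mu <;> simp only [hmC, if_true, if_false, hSC]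
          exacts [(prodC _ hc34).prod, summable_zero]
        have sδ : Summable fun v : L => if (m : ℤ) = Md then SD f' Jd v else 0 := by
          by_cases hmD : (m : ℤ) = Md <;> simp only [hmD, if_true, if_false, hSD]
          exacts [(prodC _ hc'34).prod, summable_zero]
        have eT1 : ∀ v : L, ∑' j : ℤ, ((if (m : ℤ) + j * n = i₀ then 0 else 2 * KA m f' j v)
            - (if (m : ℤ) + j * n = i₀ then SB f' v else 0)
            - (if (m : ℤ) + j * n = i₀ + 1 then SC f' j v else 0)
            - (if (m : ℤ) + j * n = i₀ - 1 then SD f' j v else 0)) =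
            2 * (∑' j : ℤ, if (m : ℤ) + j * n = i₀ then (0 : ℝ) else KA m f' j v)
              - (if (m : ℤ) = i₀ then SB f' v else 0)
              - (if (m : ℤ) = Mu then SC f' Ju v else 0)
              - (if (m : ℤ) = Md then SD f' Jd v else 0) := by
          intro v
          have sA : Summable fun j : ℤ =>
              if (m : ℤ) + j * n = i₀ then (0 : ℝ) else 2 * KA m f' j v :=
            ((h2.prod_factor v).mul_left 2).congr fun j => by split_ifs <;> simp
          have sB : Summable fun j : ℤ => if (m : ℤ) + j * n = i₀ then SB f' v else 0 :=
            summable_of_ne_finset_zero (s := {0}) fun j hj =>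
              if_neg fun h => hj (Finset.mem_singleton.2 ((idxB hm' j).1 h).2)
          have sC : Summable fun j : ℤ => if (m : ℤ) + j * n = i₀ + 1 then SC f' j v else 0 :=
            summable_of_ne_finset_zero (s := {Ju}) fun j hj =>
              if_neg fun h => hj (Finset.mem_singleton.2 ((idxC hm' j).1 h).2)
          have sD : Summable fun j : ℤ => if (m : ℤ) + j * n = i₀ - 1 then SD f' j v else 0 :=
            summable_of_ne_finset_zero (s := {Jd}) fun j hj =>
              if_neg fun h => hj (Finset.mem_singleton.2 ((idxD hm' j).1 h).2)
          rw [Summable.tsum_sub ((sA.sub sB).sub sC) sD, Summable.tsum_sub (sA.sub sB) sC,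
            Summable.tsum_sub sA sB]
          have eA : (∑' j : ℤ, if (m : ℤ) + j * n = i₀ then (0 : ℝ) else 2 * KA m f' j v) =
              2 * ∑' j : ℤ, if (m : ℤ) + j * n = i₀ then (0 : ℝ) else KA m f' j v := by
            rw [← tsum_mul_left]
            exact tsum_congr fun j => by split_ifs <;> simp
          have eB : (∑' j : ℤ, if (m : ℤ) + j * n = i₀ then SB f' v else 0) =
              if (m : ℤ) = i₀ then SB f' v else 0 := by
            simp only [idxB hm']
            by_cases hmi : (m : ℤ) = i₀ <;>
              simp only [hmi, true_and, false_and, if_true, if_false, tsum_zero]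
            exact tsum_ite_eq (0 : ℤ) fun _ => SB f' v
          have eC : (∑' j : ℤ, if (m : ℤ) + j * n = i₀ + 1 then SC f' j v else 0) =
              if (m : ℤ) = Mu then SC f' Ju v else 0 := by
            simp only [idxC hm']
            by_cases hmC : (m : ℤ) = Mu <;>
              simp only [hmC, true_and, false_and, if_true, if_false, tsum_zero]
            exact tsum_ite_eq Ju fun j => SC f' j v
          have eD : (∑' j : ℤ, if (m : ℤ) + j * n = i₀ - 1 then SD f' j v else 0) =
              if (m : ℤ) = Md then SD f' Jd v else 0 := by
            simp only [idxD hm']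
            by_cases hmD : (m : ℤ) = Md <;>
              simp only [hmD, true_and, false_and, if_true, if_false, tsum_zero]
            exact tsum_ite_eq Jd fun j => SD f' j v
          rw [eA, eB, eC, eD]
        rw [tsum_congr eT1, Summable.tsum_sub (((h2.prod.mul_left 2).sub sβ).sub sγ) sδ,
          Summable.tsum_sub ((h2.prod.mul_left 2).sub sβ) sγ,
          Summable.tsum_sub (h2.prod.mul_left 2) sβ, tsum_mul_left]
    _ = 2 * (∑ m ∈ Finset.range n, ∑ f' ∈ F m, ∑' (v : L) (j : ℤ),
            if (m : ℤ) + j * n = i₀ then (0 : ℝ) else KA m f' j v)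
          - ∑ m ∈ Finset.range n, ∑ f' ∈ F m, ∑' v : L, (if (m : ℤ) = i₀ then SB f' v else 0)
          - ∑ m ∈ Finset.range n, ∑ f' ∈ F m, ∑' v : L, (if (m : ℤ) = Mu then SC f' Ju v else 0)
          - ∑ m ∈ Finset.range n, ∑ f' ∈ F m, ∑' v : L,
              (if (m : ℤ) = Md then SD f' Jd v else 0) := by
        simp only [Finset.sum_sub_distrib, Finset.mul_sum]
    _ = _ := by
        rw [collapse i₀ (by positivity) (by exact_mod_cast hi₀), collapse Mu hMu0 hMun,
          collapse Md hMd0 hMdn, hBsplit]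
        ring

end Summit.AtomisticToContinuum.Crystallization.Theorems.ChessboardParticlePlanesLjPlaneChessboard

end
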